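import Summits.ValiantsHypothesis.ValiantsHypothesis.Theorems.KPlusLogSqLawTropicalShiftThreeChain
import Summits.ValiantsHypothesis.ValiantsHypothesis.Theorems.KPlusLogSqLawTropicalShiftThreeTightDefs
import Summits.ValiantsHypothesis.ValiantsHypothesis.Theorems.LacunarySymmetroidMatrixDescartesCensusTropicalKLawSlopes

/-!
# Route «KPlusLogSqLaw» — SHIFT-THREE-PLUS: the `K = 3` tropical census row is COUNTING-TIGHT for every `m`

HONEST FRAMING.  Proof file (pure theorems) on top of `…TropicalShiftThree{Defs,,Chain}.lean` and
`…TropicalShiftThreeTightDefs.lean` (seat val-sym-lift-p3 of the object-search cell `pub-symmetroid`, 2026-08-26; helper of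
the crux `Lifting`, item `stmt-ValiantsHypothesis-19772`, and an exact census datum for the crux `TropicalB`, item
`…-19771`).  Result:

  `tropRootLawAt_three_iff : TropRootLawAt m 3 B ↔ C(m+2,2) − 1 ≤ B`      (every `m`, every `B`),

i.e. the tropical capacity of the three-class format is EXACTLY the slope count, `T(m,3) = C(m+2,2) − 1 = D(m,3)`
(`←` is the tree's `tropRootLawAt_choose`; `→` is the explicit family below).  SHIFT-THREE realises every class histogram
except `(0,0,m)`; SHIFT-THREE-PLUS (`eeP`, `vvP`) adds class `2` on the diagonal with the huge valuation `bigV` and the final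
term `fterm = (1, all class 2)`.  Proved here: during the grid phases a diagonal class-`2` entry scores `θ·D − bigV`, below
every grid score (`phiP_diag_lt`), so the grid terms stay unique optima for the enlarged design (`isDominantP_cterm`, same
entrywise domination as `isDominant_cterm` plus this one case); a present term all of whose columns have class `2` uses only
entries `(a, b)` with `a ≤ b`, hence is the identity (`perm_eq_one_of_le`), so `fterm` is the unique term of slope `m·D` and
the unique optimum at `θ = bigV` (`isDominant_fterm`); its sign `(−1)^{T m}` continues the alternation; the chain has
`T m + 1 = C(m+2,2)` terms.  Nothing here bears on `K ≥ 4` (open fork), on `TropicalB`/`Lifting` in their window, on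
`MatrixDescartes` or on `VP ≠ VNP`.
-/

set_option linter.dupNamespace false
set_option autoImplicit false

namespace Summit.ValiantsHypothesis.ValiantsHypothesis.Theorems.LacunarySymmetroidMatrixDescartes.TropicalCensus

open Summit.ValiantsHypothesis.ValiantsHypothesis.Theorems.MatrixDescartes.Negative
open scoped BigOperators
open Finset

namespace ShiftThree

variable (n : ℕ)

/-! ### the enlarged design agrees with SHIFT-THREE off the diagonal class-`2` entries -/
/-- off the diagonal class-`2` entries the signs are those of SHIFT-THREE. -/
theorem eeP_of_not (a b : Fin (n + 1)) (l : Fin 3) (h : ¬ ((a : ℕ) = (b : ℕ) ∧ l = 2)) :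
    eeP n a b l = ee n a b l := by
  unfold eeP; rw [if_neg h]

/-- off the diagonal class-`2` entries the scores are those of SHIFT-THREE. -/
theorem phiP_of_not (θ : ℤ) (a b : Fin (n + 1)) (l : Fin 3) (h : ¬ ((a : ℕ) = (b : ℕ) ∧ l = 2)) :
    phiP n θ a b l = phi n θ a b l := by
  unfold phiP phi vvP; rw [if_neg h]

/-- the score of a diagonal class-`2` entry: `θ·D − bigV`. -/
theorem phiP_diag (θ : ℤ) (b : Fin (n + 1)) : phiP n θ b b 2 = θ * (bigD n : ℤ) - bigV n := by
  unfold phiP vvP shiftZ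
  rw [if_pos ⟨rfl, rfl⟩, dd_two, if_neg (lt_irrefl _), if_neg (lt_irrefl _)]
  ring

/-- the tropical weight of the enlarged design is the sum of its per-entry scores. -/
theorem tropWeight_eq_sum_phiP (θ : ℤ) (q : Equiv.Perm (Fin (n + 1)) × (Fin (n + 1) → Fin 3)) :
    tropWeight (dd n) (vvP n) θ q = ∑ b, phiP n θ (q.1 b) b (q.2 b) := by
  unfold tropWeight phiP
  have h0 := sum_redistribute n q.1
  rw [Finset.sum_sub_distrib, Finset.sum_add_distrib, Finset.sum_sub_distrib, ← Finset.mul_sum]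
  have h3 : ∑ b, θ * (2 * n + 5 : ℤ) * shiftZ n (q.1 b) b -
      ∑ b, θ * (bigD n : ℤ) * (if ((q.1 b : Fin (n + 1)) : ℕ) < (b : ℕ) then 1 else 0) = 0 := by
    rw [← Finset.sum_sub_distrib]
    have : ∀ b, θ * (2 * n + 5 : ℤ) * shiftZ n (q.1 b) b -
        θ * (bigD n : ℤ) * (if ((q.1 b : Fin (n + 1)) : ℕ) < (b : ℕ) then 1 else 0)
        = θ * ((2 * n + 5 : ℤ) * shiftZ n (q.1 b) b -
          (bigD n : ℤ) * (if ((q.1 b : Fin (n + 1)) : ℕ) < (b : ℕ) then 1 else 0)) := fun b => by ring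
    rw [Finset.sum_congr rfl (fun b _ => this b), ← Finset.mul_sum, h0, mul_zero]
  linarith

/-- grid terms use no diagonal class-`2` entry. -/
theorem cterm_not_diag (p a : ℕ) (hp : p ≤ n) (b : Fin (n + 1)) :
    ¬ (((rot n p b : Fin (n + 1)) : ℕ) = (b : ℕ) ∧ lam n p a b = 2) := by
  rintro ⟨h1, h2⟩
  have hv := rot_val n p hp b
  unfold lam at h2
  by_cases hw : n + 1 ≤ (b : ℕ) + p
  · rw [if_pos hw] at hv; omega
  · rw [if_neg hw] at h2
    split_ifs at h2 with hb
    · exact absurd h2 (by decide)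
    · exact absurd h2 (by decide)

/-- hence their signs are unchanged … -/
theorem termSignP_cterm (p a : ℕ) (hp : p ≤ n) :
    termSign (eeP n) (cterm n p a) = termSign (ee n) (cterm n p a) := by
  unfold termSign cterm
  dsimp only
  congr 1
  exact Finset.prod_congr rfl fun b _ => eeP_of_not n _ b _ (cterm_not_diag n p a hp b)

/-! ### dominance of the grid terms in the enlarged design -/
/-- `pen` is monotone on `[0, n]`. -/
theorem pen_le_pen (p : ℕ) (hp : p ≤ n) : pen n p ≤ pen n n := by
  unfold pen
  have h1 : (p : ℤ) * (p + 1) ≤ (n : ℤ) * (n + 1) := by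
    have : (p : ℤ) ≤ n := by exact_mod_cast hp
    nlinarith
  have h2 : (0 : ℤ) ≤ (2 * n + 5) * (n + 2) := by positivity
  nlinarith

/-- grid slopes are at most the last one, `θ(n, 1)`. -/
theorem th_le_th_last (p a : ℕ) (hp : p ≤ n) (ha : a + p ≤ n + 1) : th n p a ≤ th n n 1 := by
  unfold th
  have hp' : (p : ℤ) ≤ n := by exact_mod_cast hp
  have ha' : (a : ℤ) + p ≤ n + 1 := by exact_mod_cast ha
  have hprod := mul_nonneg (show (0 : ℤ) ≤ 2 * n + 2 by positivity) (sub_nonneg.mpr hp')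
  push_cast
  nlinarith

/-- **a diagonal class-`2` entry never competes during the grid phases**: its score is below the grid term's entry score. -/
theorem phiP_diag_lt (p a : ℕ) (hp : p ≤ n) (ha : a + p ≤ n + 1) (b : Fin (n + 1)) :
    phiP n (th n p a) b b 2 < phiP n (th n p a) (rot n p b) b (lam n p a b) := by
  rw [phiP_diag, phiP_of_not n _ _ b _ (cterm_not_diag n p a hp b), phi_cterm n _ p a hp ha b]
  have h1 := th_le_th_last n p a hp ha
  have h2 := pen_le_pen n p hp
  have hD : (0 : ℤ) ≤ (bigD n : ℤ) := by positivity
  have hθ : (0 : ℤ) ≤ th n p a := by unfold th; positivity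
  have hg : -pen n n ≤ gval n (th n p a) p := by
    unfold gval
    have : (0 : ℤ) ≤ th n p a * (2 * n + 5) * p := by positivity
    linarith
  have hb : (0 : ℤ) ≤ (if (b : ℕ) < a then th n p a - price n p b else 0) := by
    split_ifs with hb
    · have := th_sub_price n p a b
      have : (b : ℤ) + 1 ≤ a := by exact_mod_cast hb
      linarith
    · exact le_rfl
  unfold bigV
  nlinarith [mul_le_mul_of_nonneg_right h1 hD]

/-- a present entry-class of the enlarged design that is not a diagonal class-`2` entry is present in SHIFT-THREE. -/
theorem ee_ne_zero_of_eeP (a b : Fin (n + 1)) (l : Fin 3) (h : eeP n a b l ≠ 0)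
    (hnd : ¬ ((a : ℕ) = (b : ℕ) ∧ l = 2)) : ee n a b l ≠ 0 := by
  rwa [eeP_of_not n a b l hnd] at h

/-- **the grid terms remain unique optima for the enlarged design.** -/
theorem isDominantP_cterm (p a : ℕ) (hp : p ≤ n) (ha : a + p ≤ n + 1) :
    IsDominant (dd n) (vvP n) (eeP n) (th n p a) (cterm n p a) := by
  refine ⟨?_, ?_⟩
  · rw [termSignP_cterm n p a hp]; exact (isDominant_cterm n p a hp ha).1
  · intro q hq hqs
    rw [tropWeight_eq_sum_phiP, tropWeight_eq_sum_phiP]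
    have hpres : ∀ b, eeP n (q.1 b) b (q.2 b) ≠ 0 := by
      intro b
      unfold termSign at hqs
      exact (Finset.prod_ne_zero_iff.mp (right_ne_zero_of_mul hqs)) b (Finset.mem_univ b)
    -- entrywise domination
    have hle : ∀ b, phiP n (th n p a) (q.1 b) b (q.2 b) ≤ phiP n (th n p a) (rot n p b) b (lam n p a b) := by
      intro b
      by_cases hd : ((q.1 b : Fin (n + 1)) : ℕ) = (b : ℕ) ∧ q.2 b = 2
      · have hqb : q.1 b = b := Fin.ext hd.1
        rw [hqb, hd.2]
        exact (phiP_diag_lt n p a hp ha b).le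
      · rw [phiP_of_not n _ _ b _ hd, phiP_of_not n _ _ b _ (cterm_not_diag n p a hp b)]
        exact phi_le n p a hp ha (q.1 b) b (q.2 b) (ee_ne_zero_of_eeP n _ b _ (hpres b) hd)
    obtain ⟨b₀, hb₀⟩ : ∃ b, q.1 b ≠ rot n p b ∨ q.2 b ≠ lam n p a b := by
      by_contra hcon
      push Not at hcon
      apply hq
      unfold cterm
      exact Prod.ext (Equiv.ext fun b => (hcon b).1) (funext fun b => (hcon b).2)
    have hlt : phiP n (th n p a) (q.1 b₀) b₀ (q.2 b₀) < phiP n (th n p a) (rot n p b₀) b₀ (lam n p a b₀) := by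
      by_cases hd : ((q.1 b₀ : Fin (n + 1)) : ℕ) = (b₀ : ℕ) ∧ q.2 b₀ = 2
      · have hqb : q.1 b₀ = b₀ := Fin.ext hd.1
        rw [hqb, hd.2]
        exact phiP_diag_lt n p a hp ha b₀
      · rw [phiP_of_not n _ _ b₀ _ hd, phiP_of_not n _ _ b₀ _ (cterm_not_diag n p a hp b₀)]
        exact phi_lt n p a hp ha (q.1 b₀) b₀ (q.2 b₀) (ee_ne_zero_of_eeP n _ b₀ _ (hpres b₀) hd) hb₀
    unfold cterm
    exact Finset.sum_lt_sum (fun b _ => hle b) ⟨b₀, Finset.mem_univ _, hlt⟩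

/-! ### the final term -/
/-- a permutation of `Fin (n+1)` below the identity pointwise is the identity. -/
theorem perm_eq_one_of_le (σ : Equiv.Perm (Fin (n + 1))) (h : ∀ b, ((σ b : Fin (n + 1)) : ℕ) ≤ (b : ℕ)) : σ = 1 := by
  have hsum : ∑ b : Fin (n + 1), (((b : ℕ) : ℤ) - (((σ b : Fin (n + 1)) : ℕ) : ℤ)) = 0 := by
    rw [Finset.sum_sub_distrib, Equiv.sum_comp σ (fun b : Fin (n + 1) => ((b : ℕ) : ℤ)), sub_self]
  have hnn : ∀ b ∈ (Finset.univ : Finset (Fin (n + 1))),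
      (0 : ℤ) ≤ ((b : ℕ) : ℤ) - (((σ b : Fin (n + 1)) : ℕ) : ℤ) := by
    intro b _
    have := h b
    omega
  have hz := (Finset.sum_eq_zero_iff_of_nonneg hnn).mp hsum
  apply Equiv.ext
  intro b
  apply Fin.ext
  have h1 := hz b (Finset.mem_univ b)
  have h2 := h b
  rw [Equiv.Perm.coe_one, id_eq]
  omega

/-- class `2` is present only at entries `(a, b)` with `a ≤ b` (wrapping or diagonal). -/
theorem le_of_eeP_two (a b : Fin (n + 1)) (h : eeP n a b 2 ≠ 0) : (a : ℕ) ≤ (b : ℕ) := by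
  by_contra hab
  apply h
  unfold eeP ee
  rw [if_neg (fun hh => by omega), if_neg (by omega), if_neg (by decide), if_neg (by decide)]

/-- **a present term all of whose columns have class `2` is the final term.** -/
theorem eq_fterm_of_all_two (q : Equiv.Perm (Fin (n + 1)) × (Fin (n + 1) → Fin 3)) (hqs : termSign (eeP n) q ≠ 0)
    (h : ∀ b, q.2 b = 2) : q = fterm n := by
  have hpres : ∀ b, eeP n (q.1 b) b (q.2 b) ≠ 0 := by
    intro b
    unfold termSign at hqs
    exact (Finset.prod_ne_zero_iff.mp (right_ne_zero_of_mul hqs)) b (Finset.mem_univ b)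
  have hσ : q.1 = 1 := perm_eq_one_of_le n q.1 fun b => le_of_eeP_two n _ b (by rw [← h b]; exact hpres b)
  unfold fterm
  exact Prod.ext hσ (funext h)

/-- a present term other than the final term has at most `n` class-`2` columns. -/
theorem card_two_le (q : Equiv.Perm (Fin (n + 1)) × (Fin (n + 1) → Fin 3)) (hqs : termSign (eeP n) q ≠ 0)
    (hq : q ≠ fterm n) : ((Finset.univ : Finset (Fin (n + 1))).filter (fun b => q.2 b = 2)).card ≤ n := by
  have hne : ∃ b, q.2 b ≠ 2 := by
    by_contra hcon
    push Not at hcon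
    exact hq (eq_fterm_of_all_two n q hqs hcon)
  obtain ⟨b, hb⟩ := hne
  have hsub : (Finset.univ : Finset (Fin (n + 1))).filter (fun b => q.2 b = 2) ⊆ Finset.univ.erase b := by
    intro x hx
    rw [Finset.mem_filter] at hx
    rw [Finset.mem_erase]
    exact ⟨fun hxb => hb (hxb ▸ hx.2), Finset.mem_univ _⟩
  calc ((Finset.univ : Finset (Fin (n + 1))).filter (fun b => q.2 b = 2)).card
      ≤ (Finset.univ.erase b).card := Finset.card_le_card hsub
    _ = n := by rw [Finset.card_erase_of_mem (Finset.mem_univ b), Finset.card_univ, Fintype.card_fin]; omega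

/-- the slope of a present term other than the final term is at most `(n+1) + n·D`. -/
theorem slope_le (q : Equiv.Perm (Fin (n + 1)) × (Fin (n + 1) → Fin 3)) (hqs : termSign (eeP n) q ≠ 0)
    (hq : q ≠ fterm n) : ∑ b, (dd n (q.2 b) : ℤ) ≤ (n + 1) + n * (bigD n : ℤ) := by
  have h3 : ∀ l : Fin 3, l = 0 ∨ l = 1 ∨ l = 2 := by
    intro l; fin_cases l <;> simp
  have hpt : ∀ b, (dd n (q.2 b) : ℤ) ≤ 1 + (bigD n : ℤ) * (if q.2 b = 2 then 1 else 0) := by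
    intro b
    rcases h3 (q.2 b) with h | h | h
    · rw [h, dd_zero, if_neg (by decide)]; push_cast; linarith
    · rw [h, dd_one, if_neg (by decide)]; push_cast; linarith
    · rw [h, dd_two, if_pos rfl]; linarith
  have hcard := card_two_le n q hqs hq
  calc ∑ b, (dd n (q.2 b) : ℤ) ≤ ∑ b : Fin (n + 1), (1 + (bigD n : ℤ) * (if q.2 b = 2 then 1 else 0)) :=
        Finset.sum_le_sum fun b _ => hpt b
    _ = (n + 1) + (bigD n : ℤ) * (((Finset.univ : Finset (Fin (n + 1))).filter (fun b => q.2 b = 2)).card : ℤ) := by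
        rw [Finset.sum_add_distrib, Finset.sum_const, Finset.card_univ, Fintype.card_fin, ← Finset.mul_sum,
          Finset.sum_boole]
        simp
    _ ≤ (n + 1) + (bigD n : ℤ) * n := by
        have : (((Finset.univ : Finset (Fin (n + 1))).filter (fun b => q.2 b = 2)).card : ℤ) ≤ n := by
          exact_mod_cast hcard
        have hD : (0 : ℤ) ≤ (bigD n : ℤ) := by positivity
        nlinarith
    _ = (n + 1) + n * (bigD n : ℤ) := by ring

/-- all valuations of the enlarged design are nonnegative. -/
theorem vvP_nonneg (a b : Fin (n + 1)) (l : Fin 3) : 0 ≤ vvP n a b l := by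
  have hq : 0 ≤ shiftZ n a b := by unfold shiftZ; split_ifs with h <;> omega
  have hpen : 0 ≤ pen n (shiftZ n a b) := by unfold pen; positivity
  have hpr : 0 ≤ price n (shiftZ n a b) b := by unfold price; positivity
  have hV : 0 ≤ bigV n := by
    unfold bigV th pen; positivity
  unfold vvP vv
  split_ifs <;> linarith

/-- the sign of the final term is `(−1)^{T m}`. -/
theorem termSign_fterm : termSign (eeP n) (fterm n) = (-1) ^ T n (n + 1) := by
  have h1 : ∀ b : Fin (n + 1), eeP n b b 2 = if b = 0 then (-1 : ℤ) ^ T n (n + 1) else 1 := by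
    intro b
    unfold eeP
    rw [if_pos ⟨rfl, rfl⟩]
    by_cases hb : b = 0
    · rw [if_pos hb, if_pos (by rw [hb]; rfl)]
    · rw [if_neg hb, if_neg (fun h => hb (Fin.ext (by rw [h]; rfl)))]
  unfold termSign fterm
  rw [Equiv.Perm.sign_one, Units.val_one, one_mul]
  show ∏ b, eeP n b b 2 = (-1) ^ T n (n + 1)
  rw [Finset.prod_congr rfl (fun b _ => h1 b), Finset.prod_ite_eq']
  simp

/-- **the final term is the unique optimum at the slope `bigV`.** -/
theorem isDominant_fterm : IsDominant (dd n) (vvP n) (eeP n) (bigV n) (fterm n) := by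
  refine ⟨?_, ?_⟩
  · rw [termSign_fterm]; exact pow_ne_zero _ (by norm_num)
  · intro q hq hqs
    have hs := slope_le n q hqs hq
    have hv : 0 ≤ ∑ b, vvP n (q.1 b) b (q.2 b) := Finset.sum_nonneg fun b _ => vvP_nonneg n _ b _
    have hF : tropWeight (dd n) (vvP n) (bigV n) (fterm n) =
        bigV n * ((n + 1) * (bigD n : ℤ)) - (n + 1) * bigV n := by
      unfold tropWeight fterm vvP
      simp only [Equiv.Perm.coe_one, id_eq, dd_two, and_self, if_true, Finset.sum_const, Finset.card_univ,
        Fintype.card_fin, nsmul_eq_mul]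
      push_cast; ring
    have hV1 : (1 : ℤ) ≤ bigV n := by
      have hθ : (0 : ℤ) ≤ th n n 1 := by unfold th; positivity
      have hpen : (0 : ℤ) ≤ pen n n := by unfold pen; positivity
      have hD : (0 : ℤ) ≤ (bigD n : ℤ) := by positivity
      unfold bigV
      nlinarith
    have hD : (bigD n : ℤ) = (n + 1) * (2 * n + 5) := by unfold bigD; push_cast; ring
    have hD2 : (3 : ℤ) ≤ (bigD n : ℤ) - 2 * n - 2 := by rw [hD]; nlinarith
    have hkey : bigV n * ((n + 1) * (bigD n : ℤ)) - (n + 1) * bigV n - bigV n * ((n + 1) + n * (bigD n : ℤ))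
        = bigV n * ((bigD n : ℤ) - 2 * n - 2) := by ring
    have hpos : (3 : ℤ) ≤ bigV n * ((bigD n : ℤ) - 2 * n - 2) := by
      have := mul_le_mul_of_nonneg_left hD2 (by linarith : (0 : ℤ) ≤ bigV n)
      linarith
    have h1 : bigV n * ∑ b, (dd n (q.2 b) : ℤ) ≤ bigV n * ((n + 1) + n * (bigD n : ℤ)) :=
      mul_le_mul_of_nonneg_left hs (by linarith)
    rw [hF]
    unfold tropWeight
    linarith

/-! ### the extended chain and the count -/
/-- the extended slopes increase. -/
theorem thP_lt_succ (k : ℕ) (hk : k + 1 ≤ T n (n + 1)) : thP n k < thP n (k + 1) := by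
  unfold thP
  rw [if_pos (by omega)]
  by_cases h : k + 1 < T n (n + 1)
  · rw [if_pos h]; exact th_grid_lt n k hk
  · rw [if_neg h]
    obtain ⟨h1, _⟩ := grid_inv n k (by omega)
    have h2 := grid_fst_le n k (by omega)
    have h3 := th_le_th_last n _ _ h2 h1
    have hD : (1 : ℤ) ≤ (bigD n : ℤ) := by
      have : 1 ≤ bigD n := by unfold bigD; nlinarith
      exact_mod_cast this
    have hθ : (0 : ℤ) ≤ th n n 1 := by unfold th; positivity
    have hpen : (0 : ℤ) ≤ pen n n := by unfold pen; positivity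
    unfold bigV
    nlinarith

/-- every extended chain term is the unique optimum at its slope. -/
theorem isDominant_ctermP (k : ℕ) (hk : k ≤ T n (n + 1)) :
    IsDominant (dd n) (vvP n) (eeP n) (thP n k) (ctermP n k) := by
  unfold thP ctermP
  by_cases h : k < T n (n + 1)
  · rw [if_pos h, if_pos h]
    obtain ⟨h1, _⟩ := grid_inv n k (by omega)
    exact isDominantP_cterm n _ _ (grid_fst_le n k h) h1
  · rw [if_neg h, if_neg h]
    exact isDominant_fterm n

/-- the extended chain term signs are `(−1)^k`. -/
theorem termSign_ctermP (k : ℕ) (hk : k ≤ T n (n + 1)) : termSign (eeP n) (ctermP n k) = (-1) ^ k := by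
  unfold ctermP
  by_cases h : k < T n (n + 1)
  · rw [if_pos h]
    unfold cterm
    rw [show (rot n (grid n k).1, lam n (grid n k).1 (grid n k).2) = cterm n (grid n k).1 (grid n k).2 from rfl,
      termSignP_cterm n _ _ (grid_fst_le n k h), termSign_grid n k h]
  · rw [if_neg h, termSign_fterm]
    have : k = T n (n + 1) := by omega
    rw [this]

/-- the enlarged design has signs in `{−1, 0, 1}`. -/
theorem eeP_natAbs (a b : Fin (n + 1)) (l : Fin 3) : (eeP n a b l).natAbs ≤ 1 := by
  unfold eeP
  split_ifs
  · simp [Int.natAbs_pow]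
  · simp
  · exact ee_natAbs n a b l

/-- **the tropical row `(m, 3)`, `m = n + 1`, is at least `C(m+2,2) − 1`**: counting-tight. -/
theorem T_le_of_tropRootLawAt_three_succ (B : ℕ) (h : TropRootLawAt (n + 1) 3 B) : T n (n + 1) ≤ B := by
  have hmain := h (dd n) (vvP n) (eeP n) (T n (n + 1)) (fun k => thP n k) (fun k => ctermP n k)
    (eeP_natAbs n) ?_ ?_ ?_
  · exact hmain
  · refine Fin.strictMono_iff_lt_succ.mpr fun k => ?_
    simp only [Fin.val_castSucc, Fin.val_succ]
    exact thP_lt_succ n k (by omega)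
  · intro k
    exact isDominant_ctermP n k (by omega)
  · intro k
    simp only [Fin.val_castSucc, Fin.val_succ]
    rw [termSign_ctermP n k (by omega), termSign_ctermP n (k + 1) (by omega), ← pow_add,
      show (k : ℕ) + (k + 1) = 2 * k + 1 by ring, pow_succ, pow_mul]
    norm_num

end ShiftThree

/-- **The `K = 3` tropical census row is counting-tight for every `m`:** `TropRootLawAt m 3 B → C(m+2,2) − 1 ≤ B`
(SHIFT-THREE-PLUS has `C(m+2,2)` sign-alternating unique optima). -/
theorem choose_sub_one_le_of_tropRootLawAt_three (m B : ℕ) (h : TropRootLawAt m 3 B) :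
    (m + 2).choose 2 - 1 ≤ B := by
  rcases m with _ | n
  · simp
  · have h1 := ShiftThree.T_le_of_tropRootLawAt_three_succ n B h
    have h2 := ShiftThree.T_last n
    have h3 : n + 1 + 2 = n + 3 := rfl
    rw [h3]
    omega

/-- **Exact tropical capacity of the three-class format:** `TropRootLawAt m 3 B ↔ C(m+2,2) − 1 ≤ B`, i.e.
`T(m,3) = C(m+2,2) − 1` for every `m` (the slope count `tropRootLawAt_choose` is attained). -/
theorem tropRootLawAt_three_iff (m B : ℕ) : TropRootLawAt m 3 B ↔ (m + 2).choose 2 - 1 ≤ B := by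
  refine ⟨choose_sub_one_le_of_tropRootLawAt_three m B, fun h => ?_⟩
  have h1 := tropRootLawAt_choose m 3
  rw [show 3 + m - 1 = m + 2 by omega, Nat.choose_symm_add] at h1
  exact tropRootLawAt_mono h h1

end Summit.ValiantsHypothesis.ValiantsHypothesis.Theorems.LacunarySymmetroidMatrixDescartes.TropicalCensus
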